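import Mathlib
import HarnessLib

/-!
# Crux `DigitPolyUniformity` (stmt-QuantumAdvantage-1392), line `Sketch`, cycle 7 — Stub KMT-Cauchy–Schwarz

An elementary Cauchy–Schwarz step used in the derivation of the odd-progression block bound from the
Klurman–Mangerel–Teräväinen variance estimate: for finite sets `s, t ⊆ ℕ` and real arrays `W, M`,
`Σ_{m ∈ s} Σ_{a ∈ t} |W m a| ≤ √(#s · #t) · √(2 ΣΣ (W − M)² + 2 ΣΣ M²)`.
This is Cauchy–Schwarz over the product set `s ×ˢ t` (`sq_sum_le_card_mul_sum_sq`) combined with the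
pointwise inequality `W² ≤ 2 (W − M)² + 2 M²`.
-/

noncomputable section

namespace Summit.QuantumAdvantage.DigitPolyUniformity.SketchLAR.KMT

open Finset

/-- Pointwise splitting of a square: `w² ≤ 2 (w - m)² + 2 m²` (the difference is `(w - 2m)²`).
[folklore] -/
theorem cauchySchwarz_sq_le_two_mul_add (w m : ℝ) : w ^ 2 ≤ 2 * (w - m) ^ 2 + 2 * m ^ 2 := by
  nlinarith [sq_nonneg (w - 2 * m)]

/-- Cauchy–Schwarz for a double sum of absolute values over `s ×ˢ t`:
`(ΣΣ |W|)² ≤ (#s · #t) · ΣΣ W²`. [folklore] -/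
theorem cauchySchwarz_sq_sum_sum_abs_le (s t : Finset ℕ) (W : ℕ → ℕ → ℝ) :
    (∑ m ∈ s, ∑ a ∈ t, |W m a|) ^ 2 ≤ ((s.card : ℝ) * t.card) * ∑ m ∈ s, ∑ a ∈ t, (W m a) ^ 2 := by
  rw [← Finset.sum_product' s t fun m a => |W m a|, ← Finset.sum_product' s t fun m a => (W m a) ^ 2]
  calc (∑ p ∈ s ×ˢ t, |W p.1 p.2|) ^ 2
      ≤ ((s ×ˢ t).card : ℝ) * ∑ p ∈ s ×ˢ t, |W p.1 p.2| ^ 2 := sq_sum_le_card_mul_sum_sq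
    _ = ((s.card : ℝ) * t.card) * ∑ p ∈ s ×ˢ t, (W p.1 p.2) ^ 2 := by
      rw [Finset.card_product, Nat.cast_mul]
      simp only [sq_abs]

/-- **Stub KMT-CS (Cauchy–Schwarz with a main term split off).**
`Σ_{m ∈ s} Σ_{a ∈ t} |W m a| ≤ √(#s · #t) · √(2 ΣΣ (W m a − M m a)² + 2 ΣΣ (M m a)²)`. [folklore] -/
theorem stub_kmt_cauchySchwarz (s t : Finset ℕ) (W M : ℕ → ℕ → ℝ) :
    ∑ m ∈ s, ∑ a ∈ t, |W m a| ≤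
      Real.sqrt ((s.card : ℝ) * t.card) *
        Real.sqrt (2 * ∑ m ∈ s, ∑ a ∈ t, (W m a - M m a) ^ 2 + 2 * ∑ m ∈ s, ∑ a ∈ t, (M m a) ^ 2) := by
  have hN : (0 : ℝ) ≤ (s.card : ℝ) * t.card := by positivity
  have hQ : ∑ m ∈ s, ∑ a ∈ t, (W m a) ^ 2 ≤
      2 * ∑ m ∈ s, ∑ a ∈ t, (W m a - M m a) ^ 2 + 2 * ∑ m ∈ s, ∑ a ∈ t, (M m a) ^ 2 := by
    rw [Finset.mul_sum, Finset.mul_sum, ← Finset.sum_add_distrib]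
    refine Finset.sum_le_sum fun m _ => ?_
    rw [Finset.mul_sum, Finset.mul_sum, ← Finset.sum_add_distrib]
    exact Finset.sum_le_sum fun a _ => cauchySchwarz_sq_le_two_mul_add (W m a) (M m a)
  rw [← Real.sqrt_mul hN]
  exact Real.le_sqrt_of_sq_le
    ((cauchySchwarz_sq_sum_sum_abs_le s t W).trans (mul_le_mul_of_nonneg_left hQ hN))

end Summit.QuantumAdvantage.DigitPolyUniformity.SketchLAR.KMT
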